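/-
HONEST FRAMING: systematic search; no irrationality claim unless certified.
-/
import Summits.KontsevichZagierPeriods.Zeta5Search.WedgeDictionaryGhostFace
import HarnessLib

/-!
# The descent lemma: `explicitPQ` reduces to the TERMINAL points (equal-corner rays)

D2 lane, gen-1 g16 (memo `pub-zeta5-gen-1/D2-INDUCTION-g16.md` §3.13).  Write `b = b(a) = (N; b₁,…,b₇)`.
Call a region point **terminal** when it has a zero slot and all its non-zero slots carry the same value:
these are exactly the points `(N; x·𝟙_S)` with `S ⊊ {1,…,7}` — the axis `(N;0⁷)`, the rays, the `k`-equal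
corners, the `k`-max faces and the two-top rays of the memo's face-template atlas.

**Theorem `explicitPQ_of_terminal` (0 sorry).**  Under the four node-level relation families
(`CellStar`, `DictStar`, `CellPencil`, `DictPencil` of `WedgeDictionaryThreeTerm`), `explicitPQ` holds as soon as it
holds at every terminal region point.  Equivalently: the finite face-template programme of the memo only has to
treat the terminal families.

*Proof.*  Outer induction on the level `N = b₀`, inner induction on the slot sum `b₁ + ⋯ + b₇`.  At a non-terminal
region point `a` of level `N` either
* all slots are `≥ 1`: then `c = a − DS` (level `N − 2`) is a region point and PENCIL(`c`, `1`) relates `c`, `a`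
  and `a − s₁` with apex coefficient `b₁(N+1−b₁) ≠ 0` (`theorem descent_pencil`); or
* two non-zero slots `p ≠ q` carry different values: then STAR(`p`,`q`) at `a` relates `a`, `a − s_q`, `a − s_p`
  with `κ = (b_p − b_q)(N+1−b_p−b_q) ≠ 0`, the second factor vanishing only if both slots are at the top value,
  hence equal (`theorem descent_star`).
In both cases the other two members are region points (same partner index) of smaller level or smaller slot sum,
so the general 2-of-3 transfers `at_first_of_threeTerm` / `at_mid_of_threeTerm'` conclude.  The combinatorial
case analysis was also checked exhaustively on the 363 414 region points of level `≤ 9` (memo §3.13).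

Conditional only on the displayed hypotheses; nothing is asserted about them here.
-/

open Finset

namespace Summit.KontsevichZagierPeriods.Zeta5Search.WedgeDictionary

open Literature.NumberTheory.Irrationality.BrownZudilin2022 (bOfA Converges convergenceForms cellularIntegral QOf)
open Literature.NumberTheory.Transcendental (zetaValue)

/-! ## 1. General 2-of-3 transfers (non-degenerate) -/

/-- **2-of-3, first point.** A three-term relation with `α ≠ 0` transfers `explicitPQ` from the second and third
points to the first. [folklore] -/
theorem at_first_of_threeTerm {α β γ : ℚ} {a₀ a₁ a₂ : Fin 8 → ℤ} {j₀ j₁ j₂ : ℕ}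
    (hrel : ThreeTermRel α β γ a₀ a₁ a₂) (hd : DictThreeTerm α β γ a₀ a₁ a₂ j₀ j₁ j₂) (h₁ : ExplicitPQAt a₁ j₁)
    (h₂ : ExplicitPQAt a₂ j₂) (hα : α ≠ 0) : ExplicitPQAt a₀ j₀ := by
  obtain ⟨hq, hph, hp⟩ := hd
  have hq' : (α : ℝ) * (QOf a₀ : ℝ) + (β : ℝ) * (QOf a₁ : ℝ) + (γ : ℝ) * (QOf a₂ : ℝ) = 0 := by exact_mod_cast hq
  have hph' : (α : ℝ) * (dictPhat a₀ j₀ : ℝ) + (β : ℝ) * (dictPhat a₁ j₁ : ℝ) + (γ : ℝ) * (dictPhat a₂ j₂ : ℝ) = 0 := by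
    exact_mod_cast hph
  have hp' : (α : ℝ) * (dictP a₀ j₀ : ℝ) + (β : ℝ) * (dictP a₁ j₁ : ℝ) + (γ : ℝ) * (dictP a₂ j₂ : ℝ) = 0 := by
    exact_mod_cast hp
  have hα' : (α : ℝ) ≠ 0 := by exact_mod_cast hα
  unfold ThreeTermRel at hrel
  unfold ExplicitPQAt at h₁ h₂ ⊢
  rw [h₁, h₂] at hrel
  have key : (α : ℝ) * (cellularIntegral a₀ - ((QOf a₀ : ℝ) * (2 * zetaValue 5 + 4 * zetaValue 3 * zetaValue 2) -
      4 * (dictPhat a₀ j₀ : ℝ) * zetaValue 2 - 2 * (dictP a₀ j₀ : ℝ))) = 0 := by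
    linear_combination hrel - (2 * zetaValue 5 + 4 * zetaValue 3 * zetaValue 2) * hq' + 4 * zetaValue 2 * hph' +
      2 * hp'
  rcases mul_eq_zero.1 key with h | h
  · exact absurd h hα'
  · linarith

/-- **2-of-3, middle point.** A three-term relation with `β ≠ 0` transfers `explicitPQ` from the first and third
points to the middle one. [folklore] -/
theorem at_mid_of_threeTerm' {α β γ : ℚ} {a₀ a₁ a₂ : Fin 8 → ℤ} {j₀ j₁ j₂ : ℕ}
    (hrel : ThreeTermRel α β γ a₀ a₁ a₂) (hd : DictThreeTerm α β γ a₀ a₁ a₂ j₀ j₁ j₂) (h₀ : ExplicitPQAt a₀ j₀)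
    (h₂ : ExplicitPQAt a₂ j₂) (hβ : β ≠ 0) : ExplicitPQAt a₁ j₁ := by
  obtain ⟨hq, hph, hp⟩ := hd
  have hq' : (α : ℝ) * (QOf a₀ : ℝ) + (β : ℝ) * (QOf a₁ : ℝ) + (γ : ℝ) * (QOf a₂ : ℝ) = 0 := by exact_mod_cast hq
  have hph' : (α : ℝ) * (dictPhat a₀ j₀ : ℝ) + (β : ℝ) * (dictPhat a₁ j₁ : ℝ) + (γ : ℝ) * (dictPhat a₂ j₂ : ℝ) = 0 := by
    exact_mod_cast hph
  have hp' : (α : ℝ) * (dictP a₀ j₀ : ℝ) + (β : ℝ) * (dictP a₁ j₁ : ℝ) + (γ : ℝ) * (dictP a₂ j₂ : ℝ) = 0 := by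
    exact_mod_cast hp
  have hβ' : (β : ℝ) ≠ 0 := by exact_mod_cast hβ
  unfold ThreeTermRel at hrel
  unfold ExplicitPQAt at h₀ h₂ ⊢
  rw [h₀, h₂] at hrel
  have key : (β : ℝ) * (cellularIntegral a₁ - ((QOf a₁ : ℝ) * (2 * zetaValue 5 + 4 * zetaValue 3 * zetaValue 2) -
      4 * (dictPhat a₁ j₁ : ℝ) * zetaValue 2 - 2 * (dictP a₁ j₁ : ℝ))) = 0 := by
    linear_combination hrel - (2 * zetaValue 5 + 4 * zetaValue 3 * zetaValue 2) * hq' + 4 * zetaValue 2 * hph' +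
      2 * hp'
  rcases mul_eq_zero.1 key with h | h
  · exact absurd h hβ'
  · linarith

/-! ## 2. Bookkeeping: level, slot sum, the PENCIL base `a − DS` -/

/-- The slot sum `b₁ + ⋯ + b₇` (so that `d = 3b₀ −` slot sum). -/
def slotSum (a : Fin 8 → ℤ) : ℤ := bOfA a 1 + bOfA a 2 + bOfA a 3 + bOfA a 4 + bOfA a 5 + bOfA a 6 + bOfA a 7

/-- A slot-down move lowers the slot sum by one. -/
theorem slotSum_add_slotDown (a : Fin 8 → ℤ) {k : ℕ} (hk : k ∈ Icc 1 7) :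
    slotSum (a + slotDown k) = slotSum a - 1 := by
  simp only [mem_Icc] at hk
  obtain ⟨h1, h7⟩ := hk
  interval_cases k <;> simp [slotSum, bOfA, slotDown] <;> ring1

/-- The level `b₀ = a₁ + a₂ + a₃` of a region point is non-negative. -/
theorem level_nonneg {a : Fin 8 → ℤ} {j : ℕ} (hr : RegionHyp a j) : 0 ≤ bOfA a 0 := by
  obtain ⟨hj, hconv, hbox, hd, hpart⟩ := hr
  have hF := forms_of_converges hconv
  simp only [bOfA]
  omega

/-- Each slot is bounded by the slot sum (the other slots of a region point are non-negative). -/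
theorem le_slotSum {a : Fin 8 → ℤ} {j p : ℕ} (hr : RegionHyp a j) (hp : p ∈ Icc 1 7) : bOfA a p ≤ slotSum a := by
  have hbox := hr.2.2.1
  have hb1 := hbox 1 (by simp)
  have hb2 := hbox 2 (by simp)
  have hb3 := hbox 3 (by simp)
  have hb4 := hbox 4 (by simp)
  have hb5 := hbox 5 (by simp)
  have hb6 := hbox 6 (by simp)
  have hb7 := hbox 7 (by simp)
  have hp7 : p ≤ 7 := (mem_Icc.1 hp).2
  have hp1 : 1 ≤ p := (mem_Icc.1 hp).1
  interval_cases p <;> simp only [slotSum] <;> omega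

/-- Dual coordinates of the PENCIL base `a − DS`: the level drops by two, every slot by one. -/
theorem bOfA_sub_dsUp (a : Fin 8 → ℤ) (n : ℕ) (hn : n ≤ 7) :
    bOfA (a - dsUp) n = if n = 0 then bOfA a 0 - 2 else bOfA a n - 1 := by
  interval_cases n <;> simp [bOfA, dsUp] <;> ring1

/-- `d` goes up by one from `a` to the PENCIL base `a − DS`. -/
theorem dOf_bOfA_sub_dsUp (a : Fin 8 → ℤ) : dOf (bOfA (a - dsUp)) = dOf (bOfA a) + 1 := by
  simp [dOf, Finset.sum_range_succ, bOfA, dsUp]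
  ring1

/-- **The PENCIL base is a region point.** If every slot of the region point `a` is `≥ 1` then `a − DS`
(level `N − 2`, all slots lowered by one) is again a region point with the same partner index. [folklore] -/
theorem regionHyp_sub_dsUp {a : Fin 8 → ℤ} {j : ℕ} (hr : RegionHyp a j) (hpos : ∀ i ∈ Icc 1 7, 1 ≤ bOfA a i) :
    RegionHyp (a - dsUp) j := by
  obtain ⟨hj, hconv, hbox, hd, hpart⟩ := hr
  have hF := forms_of_converges hconv
  have hj7 : j ≤ 7 := (mem_Icc.1 hj).2
  have hj1 : 1 ≤ j := (mem_Icc.1 hj).1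
  have h1 := hpos 1 (by simp)
  have h2 := hpos 2 (by simp)
  have h3 := hpos 3 (by simp)
  have h4 := hpos 4 (by simp)
  have h5 := hpos 5 (by simp)
  have h6 := hpos 6 (by simp)
  have h7 := hpos 7 (by simp)
  have hb1 := hbox 1 (by simp)
  have hb2 := hbox 2 (by simp)
  have hb3 := hbox 3 (by simp)
  have hb4 := hbox 4 (by simp)
  have hb5 := hbox 5 (by simp)
  have hb6 := hbox 6 (by simp)
  have hb7 := hbox 7 (by simp)
  simp only [bOfA] at h1 h2 h3 h4 h5 h6 h7 hb1 hb2 hb3 hb4 hb5 hb6 hb7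
  refine ⟨hj, ?_, ?_, ?_, ?_⟩
  · apply converges_of_forms
    simp [dsUp]
    omega
  · intro i hi
    have hi7 : i ≤ 7 := (mem_Icc.1 hi).2
    have hi1 : 1 ≤ i := (mem_Icc.1 hi).1
    have hb := hbox i hi
    have hp := hpos i hi
    rw [bOfA_sub_dsUp a i hi7, bOfA_sub_dsUp a 0 (by norm_num), if_neg (by omega : i ≠ 0), if_pos rfl]
    omega
  · rw [dOf_bOfA_sub_dsUp a]
    omega
  · rw [bOfA_sub_dsUp a j hj7, bOfA_sub_dsUp a 0 (by norm_num), if_neg (by omega : j ≠ 0), if_pos rfl]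
    omega

/-! ## 3. Terminal points and the two descent steps -/

/-- **Terminal point**: some slot is zero and all non-zero slots are equal, i.e. `b = (N; x·𝟙_S)` with
`S ⊊ {1,…,7}` (the axis, rays, `k`-equal corners, `k`-max faces, two-top rays). -/
def Terminal (a : Fin 8 → ℤ) : Prop :=
  (∃ i ∈ Icc 1 7, bOfA a i = 0) ∧
    ∀ i ∈ Icc 1 7, ∀ k ∈ Icc 1 7, bOfA a i ≠ 0 → bOfA a k ≠ 0 → bOfA a i = bOfA a k

/-- **PENCIL descent step.** At a region point `a` with all slots `≥ 1`, `explicitPQ` at the base `a − DS` and at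
`a − s₁` (same partner) give `explicitPQ` at `a`: apex coefficient `b₁(N+1−b₁) ≠ 0`. [folklore] -/
theorem descent_pencil (hcP : CellPencil) (hdP : DictPencil) {a : Fin 8 → ℤ} {j : ℕ} (hr : RegionHyp a j)
    (hpos : ∀ i ∈ Icc 1 7, 1 ≤ bOfA a i) (h₀ : ExplicitPQAt (a - dsUp) j)
    (h₂ : ExplicitPQAt (a + slotDown 1) j) : ExplicitPQAt a j := by
  have one7 : (1 : ℕ) ∈ Icc 1 7 := by simp
  have hca : a - dsUp + dsUp = a := sub_add_cancel a dsUp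
  have r₀ : RegionHyp (a - dsUp) j := regionHyp_sub_dsUp hr hpos
  have r₁ : RegionHyp (a - dsUp + dsUp) j := by rw [hca]; exact hr
  have r₂ : RegionHyp (a - dsUp + dsUp + slotDown 1) j := by
    rw [hca]; exact regionHyp_slotDown hr one7 (hpos 1 one7)
  have hrel := hcP (a - dsUp) 1 j j j one7 r₀ r₁ r₂
  have hdic := hdP (a - dsUp) 1 j j j one7 r₀ r₁ r₂
  have hb1 := hr.2.2.1 1 one7
  have hp1 := hpos 1 one7
  have hβ : ((pencilApex (bOfA (a - dsUp)) 1 : ℤ) : ℚ) ≠ 0 := by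
    have hne : pencilApex (bOfA (a - dsUp)) 1 ≠ 0 := by
      unfold pencilApex
      rw [bOfA_sub_dsUp a 1 (by norm_num), bOfA_sub_dsUp a 0 (by norm_num), if_neg (by norm_num), if_pos rfl]
      exact mul_ne_zero (by omega) (by omega)
    exact_mod_cast hne
  have h := at_mid_of_threeTerm' hrel hdic h₀ (by rw [hca]; exact h₂) hβ
  rw [hca] at h
  exact h

/-- **STAR descent step.** At a region point `a` with two non-zero slots `p ≠ q` of different values, `explicitPQ`
at `a − s_q` and `a − s_p` (same partner) give `explicitPQ` at `a`: `κ = (b_p−b_q)(N+1−b_p−b_q) ≠ 0`. [folklore] -/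
theorem descent_star (hcS : CellStar) (hdS : DictStar) {a : Fin 8 → ℤ} {j p q : ℕ} (hr : RegionHyp a j)
    (hp : p ∈ Icc 1 7) (hq : q ∈ Icc 1 7) (hp1 : 1 ≤ bOfA a p) (hq1 : 1 ≤ bOfA a q)
    (hne : bOfA a p ≠ bOfA a q) (h₁ : ExplicitPQAt (a + slotDown q) j) (h₂ : ExplicitPQAt (a + slotDown p) j) :
    ExplicitPQAt a j := by
  have hpq : p ≠ q := by
    rintro rfl
    exact hne rfl
  have r₁ : RegionHyp (a + slotDown q) j := regionHyp_slotDown hr hq hq1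
  have r₂ : RegionHyp (a + slotDown p) j := regionHyp_slotDown hr hp hp1
  have hrel := hcS a p q j j j hp hq hpq hr r₁ r₂
  have hdic := hdS a p q j j j hp hq hpq hr r₁ r₂
  have hbp := hr.2.2.1 p hp
  have hbq := hr.2.2.1 q hq
  have hα : ((starKappa (bOfA a) p q : ℤ) : ℚ) ≠ 0 := by
    have hne' : starKappa (bOfA a) p q ≠ 0 := by
      unfold starKappa
      exact mul_ne_zero (sub_ne_zero.2 hne) (by omega)
    exact_mod_cast hne'
  exact at_first_of_threeTerm hrel hdic h₁ h₂ hα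

/-! ## 4. The level step and the global reduction -/

/-- **Level descent.** Under the four families: if `explicitPQ` holds (for every admissible partner) at every
region point of level `N − 2` and at every terminal region point of level `N`, it holds at every region point of
level `N`.  Inner induction on the slot sum. [folklore] -/
theorem explicitPQAt_level_of_terminal (hcS : CellStar) (hdS : DictStar) (hcP : CellPencil) (hdP : DictPencil)
    {N : ℤ} (hlow : ∀ (c : Fin 8 → ℤ) (j : ℕ), bOfA c 0 = N - 2 → RegionHyp c j → ExplicitPQAt c j)
    (hterm : ∀ (a : Fin 8 → ℤ) (j : ℕ), bOfA a 0 = N → Terminal a → RegionHyp a j → ExplicitPQAt a j) :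
    ∀ (a : Fin 8 → ℤ) (j : ℕ), bOfA a 0 = N → RegionHyp a j → ExplicitPQAt a j := by
  suffices H : ∀ s : ℕ, ∀ (a : Fin 8 → ℤ) (j : ℕ), bOfA a 0 = N → RegionHyp a j → (slotSum a).toNat = s →
      ExplicitPQAt a j from fun a j hN hr => H _ a j hN hr rfl
  intro s
  induction s using Nat.strong_induction_on with
  | _ s ih =>
    intro a j hN hr hs
    have hbox := hr.2.2.1
    have hb1 := hbox 1 (by simp)
    have hb2 := hbox 2 (by simp)
    have hb3 := hbox 3 (by simp)
    have hb4 := hbox 4 (by simp)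
    have hb5 := hbox 5 (by simp)
    have hb6 := hbox 6 (by simp)
    have hb7 := hbox 7 (by simp)
    have hss : 0 ≤ slotSum a := by
      simp only [slotSum]
      omega
    by_cases hpos : ∀ i ∈ Icc 1 7, 1 ≤ bOfA a i
    · -- PENCIL step: base `a − DS` at level `N − 2`, third point `a − s₁` of smaller slot sum
      have one7 : (1 : ℕ) ∈ Icc 1 7 := by simp
      have h₀ : ExplicitPQAt (a - dsUp) j :=
        hlow (a - dsUp) j (by rw [bOfA_sub_dsUp a 0 (by norm_num), if_pos rfl, hN]) (regionHyp_sub_dsUp hr hpos)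
      have hge : bOfA a 1 ≤ slotSum a := le_slotSum hr one7
      have hp1 := hpos 1 one7
      have hlt : (slotSum (a + slotDown 1)).toNat < s := by
        rw [slotSum_add_slotDown a one7]
        omega
      have hN' : bOfA (a + slotDown 1) 0 = N := by
        rw [bOfA_add_slotDown a 1 one7 0 (by norm_num), if_neg (by norm_num)]
        exact hN
      have h₂ : ExplicitPQAt (a + slotDown 1) j :=
        ih _ hlt (a + slotDown 1) j hN' (regionHyp_slotDown hr one7 (hpos 1 one7)) rfl
      exact descent_pencil hcP hdP hr hpos h₀ h₂
    · push Not at hpos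
      obtain ⟨i₀, hi₀, hz⟩ := hpos
      by_cases hdis : ∃ p ∈ Icc 1 7, ∃ q ∈ Icc 1 7, bOfA a p ≠ 0 ∧ bOfA a q ≠ 0 ∧ bOfA a p ≠ bOfA a q
      · -- STAR step: both other members have smaller slot sum
        obtain ⟨p, hp, q, hq, hp0, hq0, hpq⟩ := hdis
        have hp1 : 1 ≤ bOfA a p := by
          have := hbox p hp
          omega
        have hq1 : 1 ≤ bOfA a q := by
          have := hbox q hq
          omega
        have hp' : 1 ≤ p := (mem_Icc.1 hp).1
        have hq' : 1 ≤ q := (mem_Icc.1 hq).1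
        have hNq : bOfA (a + slotDown q) 0 = N := by
          rw [bOfA_add_slotDown a q hq 0 (by norm_num), if_neg (show (0 : ℕ) ≠ q by omega)]
          exact hN
        have hNp : bOfA (a + slotDown p) 0 = N := by
          rw [bOfA_add_slotDown a p hp 0 (by norm_num), if_neg (show (0 : ℕ) ≠ p by omega)]
          exact hN
        have hge : bOfA a q ≤ slotSum a := le_slotSum hr hq
        have hltq : (slotSum (a + slotDown q)).toNat < s := by
          rw [slotSum_add_slotDown a hq]
          omega
        have hltp : (slotSum (a + slotDown p)).toNat < s := by
          rw [slotSum_add_slotDown a hp]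
          omega
        have h₁ : ExplicitPQAt (a + slotDown q) j :=
          ih _ hltq (a + slotDown q) j hNq (regionHyp_slotDown hr hq hq1) rfl
        have h₂ : ExplicitPQAt (a + slotDown p) j :=
          ih _ hltp (a + slotDown p) j hNp (regionHyp_slotDown hr hp hp1) rfl
        exact descent_star hcS hdS hr hp hq hp1 hq1 hpq h₁ h₂
      · -- terminal
        have hT : Terminal a := by
          refine ⟨⟨i₀, hi₀, ?_⟩, ?_⟩
          · have := hbox i₀ hi₀
            omega
          · intro p hp q hq hp0 hq0
            by_contra hne
            exact hdis ⟨p, hp, q, hq, hp0, hq0, hne⟩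
        exact hterm a j hN hT hr

/-- **THE DESCENT THEOREM (PROVED).**  Under the four node-level relation families, `explicitPQ` holds as soon as it
holds at every TERMINAL region point `(N; x·𝟙_S)`, `S ⊊ {1,…,7}` — where, at a terminal point of level `N`,
`explicitPQ` at all region points of lower level may be assumed (this is the interface the memo's face templates
deliver).  Outer induction on the level, inner induction on the slot sum (`explicitPQAt_level_of_terminal`).
[folklore] -/
theorem explicitPQ_of_terminal (hcS : CellStar) (hdS : DictStar) (hcP : CellPencil) (hdP : DictPencil)
    (hterm : ∀ (a : Fin 8 → ℤ) (j : ℕ), Terminal a → RegionHyp a j →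
      (∀ (c : Fin 8 → ℤ) (j' : ℕ), bOfA c 0 < bOfA a 0 → RegionHyp c j' → ExplicitPQAt c j') → ExplicitPQAt a j) :
    explicitPQ := by
  rw [explicitPQ_iff_at]
  suffices H : ∀ n : ℕ, ∀ (a : Fin 8 → ℤ) (j : ℕ), (bOfA a 0).toNat = n → RegionHyp a j → ExplicitPQAt a j from
    fun a j hr => H _ a j rfl hr
  intro n
  induction n using Nat.strong_induction_on with
  | _ n ih =>
    intro a j hn hr
    have hN0 : 0 ≤ bOfA a 0 := level_nonneg hr
    refine explicitPQAt_level_of_terminal hcS hdS hcP hdP (N := bOfA a 0) ?_ ?_ a j rfl hr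
    · intro c j' hc hr'
      have hc0 : 0 ≤ bOfA c 0 := level_nonneg hr'
      have hlt : (bOfA c 0).toNat < n := by
        rw [← hn]
        omega
      exact ih _ hlt c j' rfl hr'
    · intro a' j' ha' hT hr'
      refine hterm a' j' hT hr' ?_
      intro c j'' hlt' hrc
      have hc0 : 0 ≤ bOfA c 0 := level_nonneg hrc
      exact ih _ (by omega) c j'' rfl hrc

/-- Shape sanity (the reduction is genuine, not vacuous): `explicitPQ` gives the terminal hypothesis back. -/
theorem terminal_of_explicitPQ (h : explicitPQ) :
    ∀ (a : Fin 8 → ℤ) (j : ℕ), Terminal a → RegionHyp a j →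
      (∀ (c : Fin 8 → ℤ) (j' : ℕ), bOfA c 0 < bOfA a 0 → RegionHyp c j' → ExplicitPQAt c j') → ExplicitPQAt a j := by
  rw [explicitPQ_iff_at] at h
  exact fun a j _ hr _ => h a j hr

/-- The `{1,6}` two-top RAY points `G_n` are terminal (the face theorem `explicitPQAt_twoTop16` then disposes of
the whole face from the single datum `G_0`). -/
theorem terminal_ghostA (n : ℕ) : Terminal (ghostA n) := by
  obtain ⟨h0, h1, h2, h3, h4, h5, h6, h7⟩ := bOfA_ghostA n
  have hv : ∀ i ∈ Icc 1 7, bOfA (ghostA n) i = 0 ∨ bOfA (ghostA n) i = (n : ℤ) + 1 := by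
    intro i hi
    have hi7 : i ≤ 7 := (mem_Icc.1 hi).2
    have hi1 : 1 ≤ i := (mem_Icc.1 hi).1
    interval_cases i <;> simp [h1, h2, h3, h4, h5, h6, h7]
  refine ⟨⟨2, by simp, h2⟩, ?_⟩
  intro i hi k hk hi0 hk0
  rcases hv i hi with h | h
  · exact absurd h hi0
  · rcases hv k hk with h' | h'
    · exact absurd h' hk0
    · rw [h, h']

end Summit.KontsevichZagierPeriods.Zeta5Search.WedgeDictionary
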